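import Literature.MathematicalPhysics.QuantumFieldTheory.Balaban1983to89.T4TowerRateComposition
import Literature.MathematicalPhysics.QuantumFieldTheory.Balaban1983to89.T4TermwiseBudget
import Literature.MathematicalPhysics.QuantumFieldTheory.Balaban1983to89.B14

/-!
# BalabanUVNodes ∕ N19 size window — [III] Theorem 2 (2.43) AS PRINTED against the term-wise SIZE binder of node U5
# (spine estimate NE7 = DAG node N19, route R1 «term-wise»): the large-field volumes `|Γ_n ∩ Ω|`, `j ≤ n ≤ k`, of the
# printed right side cost a POLYNOMIAL weight in the cutoff on the recent log window, and the END `GoodClause ∧ Summable δ`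
# survives it (NE7 pricing desk WATCH W-NE7-1, `PRICING-NE7.md` v81 §2 CM-5 (iii); cell `pub-ymgap`, Track A, cluster K5
# «SpineMatching», seat dag-n19-b; count-neutral)

HONEST FRAMING.  Estimate NE7 (matching of the two runs' dressed partition functions modulo constants with a summable
remainder; tree shapes `T4CauchySum.MatchingModConstants`, `T4GoodClassBudget.GoodClause` = `Spine.NE7.Core`) is NOT
PRINTED anywhere in [Balaban1987RG1]–[Balaban1989LargeFieldII] and is NOT proved here.  This module is real-number
bookkeeping on the TERM-WISE route of record (`T4TowerRateComposition` §5–§6): its per-slice SIZE radii are typed in the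
ALL-REGULAR shape `S_j ≤ vol·E·a^{K−j}` (`termRadius_le_crossoverDeltaPoly`, hypothesis `hSE`; `a = L^{−β}`), whereas the
printed one-run size bound it is read from — Theorem 2 (2.43) p. 263 of [Balaban1988Convergent], typed verbatim as the
E-clause of `B14.Thm2Printed` — reads `E₁ Σ_{n=j}^{k} (L^{j−n})^β |Γ_n ∩ Ω|` and CARRIES THE LARGE-FIELD VOLUMES of the
levels `j ≤ n ≤ k` («The volumes are taken in the corresponding scales, i.e. |Γ_n∩Ω| means the number of points in the set
Γ_n∩Ω ⊂ T_1^{(n)}.»).  For a GOOD term of the recent log window (no pending large-field structure below level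
`jlog(K) = K − ⌈Cl·log(K+1)⌉`, tree `T4GoodClassBudget.jlogOf`) those volumes vanish below the window and are at most
`vol·G^{K−n}` inside it (trivial counting, `G` = points of `T_1^{(n)}` per unit cube one level up); §1 shows that the printed
right side is then `≤ vol·P(K)·a^{K−j}` with an EXPLICIT polynomial `P`, §2 that the E-branch of the crossover majorant
with a polynomially growing size constant is still summable over the cutoff, §3 re-proves the route's END
(`goodClause_summable_of_termBudget`) with the repaired binder, and §4 reads the input shape off `B14.Thm2Printed` BY NAME
(`(L^{j−n})^β = a^{n−j}`).  Nothing here is an estimate about Bałaban's expansions: WHICH terms are good, and that their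
(2.43)-volumes have the window profile, is decidable only on the two-run ledger of Bałaban's (2.18) representation (cell
NODE O ∕ NODE 00 Stage 5 — not in the tree); the polynomial repair is recorded so that the instantiation does not meet the
all-regular binder by a bounce.  One fixed finite torus, rung (B)+1; NOT infinite volume, NOT a mass gap, NOT Clay.

CITATION HEADER.  [Balaban1988Convergent] T. Bałaban, *Convergent renormalization expansions for lattice gauge theories*,
Commun. Math. Phys. **119** (1988) 243–285, Theorem 2 p. 263, (2.43): «| Σ_{z∈Λ_j^0∩Ω} [E^{(j)}(Λ_j, U_k, z) − E^{(j)}(Λ_j, 1,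
z)] − β_j(g_{j−1}) A(φ, U_k) | ≤ E₁ Σ_{n=j}^{k} (L^{j−n})^β |Γ_n ∩ Ω|, (2.43) for β < 1, and sufficiently regular
configurations U_k = U_k(V)» and «The volumes are taken in the corresponding scales» — quoted from the docstring of the
tree's `B14.Thm2Printed` (cell `pub-balaban` page store), used ONLY as the SHAPE of a hypothesis (`B14.Thm2Printed` is a
`def … : Prop`, never asserted).  The located watch: `run/shared/lean/pub/pub-balaban/b2b-balaban-t4-ne7-refuter/PRICING-NE7.md`
v81 §2 CM-5 (iii) «W-NE7-1 … R1's SIZE binder is the ALL-REGULAR shape only … Repair: S ≤ vol·E·(K+1)^m·a^{K−j}».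

WHAT IS PROVED is [folklore] arithmetic (finite sums, `Real.rpow`, comparison of series); no `def`; 0 `sorry`; standard
axioms; imports the tree's `T4TowerRateComposition` (+ its `T4GoodClassBudget`, `T4Crossover`, `T4CauchySum`) and `B14` only.
NOT a node discharge (YM-PLAN §1): N19's statement of record `Spine.NE7.Core` is untouched; this file serves the crux
`SpineGivenEndpoint` (stmt-QuantumFields-19182) as a `--supports` helper on N19's term-wise chain.
-/

open Finset

namespace Summit.QuantumFields.YangMills.BalabanUVNodes.N19SizeWindow

open Literature.MathematicalPhysics.QuantumFieldTheory.Balaban1983to89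
open T4GoodClassBudget T4TowerRateComposition T4Crossover T4CauchySum

/-! ## §1 The printed right side of (2.43) on the recent log window is `vol·P(K)·a^{K−j}` -/

/-- **WINDOW PROFILE ⇒ ALL-REGULAR SHAPE WITH A WEIGHT.**  Let `0 < a ≤ 1 ≤ G`, `0 ≤ vol`, `j ≤ K`, and let the level
volumes `Γ n` of the printed right side of (2.43) (at `k = K`) satisfy: `Γ K ≤ vol` (the current region), `Γ n = 0` for
`n < jlo` (no pending structure below the window) and `Γ n ≤ vol·G^{K−n}` for `jlo ≤ n < K` (trivial counting inside it).
Then `Σ_{n=j}^{K} a^{n−j} Γ n ≤ vol·(1 + (K − jlo)·(G∕a)^{K−jlo})·a^{K−j}`. [folklore] -/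
theorem sum_window_le {a vol G : ℝ} {Γ : ℕ → ℝ} {j jlo K : ℕ} (ha0 : 0 < a) (ha1 : a ≤ 1) (hG : 1 ≤ G)
    (hvol : 0 ≤ vol) (hjK : j ≤ K) (hΓK : Γ K ≤ vol)
    (hΓold : ∀ n, n < K → n < jlo → Γ n = 0) (hΓwin : ∀ n, n < K → jlo ≤ n → Γ n ≤ vol * G ^ (K - n)) :
    ∑ n ∈ Icc j K, a ^ (n - j) * Γ n
      ≤ vol * (1 + ((K - jlo : ℕ) : ℝ) * (G / a) ^ (K - jlo)) * a ^ (K - j) := by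
  have hGa : 1 ≤ G / a := by
    rw [le_div_iff₀ ha0, one_mul]; exact ha1.trans hG
  have hGa0 : 0 ≤ G / a := zero_le_one.trans hGa
  -- split off the top level `n = K`
  have hsplit : Icc j K = insert K (Ico j K) := by
    ext n; simp only [mem_Icc, mem_insert, mem_Ico]; omega
  have hKnot : K ∉ Ico j K := by simp
  rw [hsplit, sum_insert hKnot]
  -- the top level
  have htop : a ^ (K - j) * Γ K ≤ vol * a ^ (K - j) := by
    rw [mul_comm]; exact mul_le_mul_of_nonneg_right hΓK (pow_nonneg ha0.le _)
  -- the window levels: each term ≤ vol·(G/a)^{K−jlo}·a^{K−j}, and there are at most `K − jlo` nonzero ones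
  set c : ℝ := vol * (G / a) ^ (K - jlo) * a ^ (K - j) with hc
  have hc0 : 0 ≤ c := by rw [hc]; positivity
  have hterm : ∀ n ∈ (Ico j K).filter (fun n => jlo ≤ n), a ^ (n - j) * Γ n ≤ c := by
    intro n hn
    rw [mem_filter, mem_Ico] at hn
    obtain ⟨⟨hjn, hnK⟩, hlon⟩ := hn
    have hw := hΓwin n hnK hlon
    have hsplitpow : a ^ (K - j) = a ^ (n - j) * a ^ (K - n) := by
      rw [← pow_add]; congr 1; omega
    have hratio : G ^ (K - n) = (G / a) ^ (K - n) * a ^ (K - n) := by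
      rw [← mul_pow, div_mul_cancel₀ G ha0.ne']
    calc a ^ (n - j) * Γ n ≤ a ^ (n - j) * (vol * G ^ (K - n)) :=
          mul_le_mul_of_nonneg_left hw (pow_nonneg ha0.le _)
      _ = vol * (G / a) ^ (K - n) * (a ^ (n - j) * a ^ (K - n)) := by rw [hratio]; ring
      _ = vol * (G / a) ^ (K - n) * a ^ (K - j) := by rw [hsplitpow]
      _ ≤ vol * (G / a) ^ (K - jlo) * a ^ (K - j) := by
          refine mul_le_mul_of_nonneg_right (mul_le_mul_of_nonneg_left ?_ hvol) (pow_nonneg ha0.le _)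
          exact pow_le_pow_right₀ hGa (by omega)
  have hzero : ∑ n ∈ Ico j K, a ^ (n - j) * Γ n = ∑ n ∈ (Ico j K).filter (fun n => jlo ≤ n), a ^ (n - j) * Γ n := by
    rw [sum_filter]
    refine sum_congr rfl fun n hn => ?_
    split_ifs with h
    · rfl
    · rw [hΓold n (mem_Ico.mp hn).2 (not_le.mp h), mul_zero]
  have hcard : ((Ico j K).filter (fun n => jlo ≤ n)).card ≤ K - jlo := by
    calc ((Ico j K).filter (fun n => jlo ≤ n)).card ≤ (Ico jlo K).card :=
          card_le_card fun n hn => by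
            rw [mem_filter, mem_Ico] at hn; rw [mem_Ico]; exact ⟨hn.2, hn.1.2⟩
      _ = K - jlo := Nat.card_Ico jlo K
  have hwin : ∑ n ∈ Ico j K, a ^ (n - j) * Γ n ≤ ((K - jlo : ℕ) : ℝ) * c := by
    rw [hzero]
    calc ∑ n ∈ (Ico j K).filter (fun n => jlo ≤ n), a ^ (n - j) * Γ n
        ≤ ((Ico j K).filter (fun n => jlo ≤ n)).card • c := sum_le_card_nsmul _ _ _ hterm
      _ = (((Ico j K).filter (fun n => jlo ≤ n)).card : ℝ) * c := by rw [nsmul_eq_mul]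
      _ ≤ ((K - jlo : ℕ) : ℝ) * c := mul_le_mul_of_nonneg_right (by exact_mod_cast hcard) hc0
  calc a ^ (K - j) * Γ K + ∑ n ∈ Ico j K, a ^ (n - j) * Γ n ≤ vol * a ^ (K - j) + ((K - jlo : ℕ) : ℝ) * c :=
        add_le_add htop hwin
    _ = vol * (1 + ((K - jlo : ℕ) : ℝ) * (G / a) ^ (K - jlo)) * a ^ (K - j) := by rw [hc]; ring

/-- **ON THE LOG WINDOW THE WEIGHT IS POLYNOMIAL IN THE CUTOFF.**  With `jlo = jlog(K) = K − ⌈Cl·log(K+1)⌉`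
(`T4GoodClassBudget.jlogOf`), `Cl ≥ 0`: `1 + (K − jlog K)·(G∕a)^{K − jlog K} ≤ (1 + (Cl+1)·(G∕a))·(K+1)^{⌈Cl·log(G∕a)⌉+1}`
(`T4GoodClassBudget.sub_jlogOf_le`, `pow_logWindow_le`, `log(K+1) ≤ K`). [folklore] -/
theorem windowWeight_log_le {a G Cl : ℝ} (ha0 : 0 < a) (ha1 : a ≤ 1) (hG : 1 ≤ G) (hCl : 0 ≤ Cl) (K : ℕ) :
    1 + ((K - jlogOf Cl K : ℕ) : ℝ) * (G / a) ^ (K - jlogOf Cl K)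
      ≤ (1 + (Cl + 1) * (G / a)) * ((K : ℝ) + 1) ^ (⌈Cl * Real.log (G / a)⌉₊ + 1) := by
  have hGa : 1 ≤ G / a := by
    rw [le_div_iff₀ ha0, one_mul]; exact ha1.trans hG
  have hGa0 : 0 < G / a := one_pos.trans_le hGa
  have hK0 : (0 : ℝ) ≤ (K : ℝ) := Nat.cast_nonneg K
  have hK1 : (1 : ℝ) ≤ (K : ℝ) + 1 := by linarith
  have hKp : (0 : ℝ) < (K : ℝ) + 1 := by positivity
  set N : ℕ := ⌈Cl * Real.log (G / a)⌉₊ with hN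
  -- length of the window
  have hlen : ((K - jlogOf Cl K : ℕ) : ℝ) ≤ (Cl + 1) * ((K : ℝ) + 1) := by
    have h1 := sub_jlogOf_le hCl K
    have hlog : Real.log ((K : ℝ) + 1) ≤ (K : ℝ) + 1 - 1 := Real.log_le_sub_one_of_pos hKp
    have h2 : Cl * Real.log ((K : ℝ) + 1) ≤ Cl * ((K : ℝ) + 1) := by
      have := mul_le_mul_of_nonneg_left hlog hCl; nlinarith
    nlinarith
  -- largest volume factor of the window
  have hpow : (G / a) ^ (K - jlogOf Cl K) ≤ (G / a) * ((K : ℝ) + 1) ^ N := by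
    refine (pow_logWindow_le hGa hCl K).trans (mul_le_mul_of_nonneg_left ?_ hGa0.le)
    calc ((K : ℝ) + 1) ^ (Cl * Real.log (G / a)) ≤ ((K : ℝ) + 1) ^ ((N : ℕ) : ℝ) :=
          Real.rpow_le_rpow_of_exponent_le hK1 (by rw [hN]; exact Nat.le_ceil _)
      _ = ((K : ℝ) + 1) ^ N := Real.rpow_natCast _ _
  have hKN : (1 : ℝ) ≤ ((K : ℝ) + 1) ^ (N + 1) := one_le_pow₀ hK1
  have hKN' : ((K : ℝ) + 1) * ((K : ℝ) + 1) ^ N = ((K : ℝ) + 1) ^ (N + 1) := by ring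
  have hprod : ((K - jlogOf Cl K : ℕ) : ℝ) * (G / a) ^ (K - jlogOf Cl K)
      ≤ ((Cl + 1) * ((K : ℝ) + 1)) * ((G / a) * ((K : ℝ) + 1) ^ N) :=
    mul_le_mul hlen hpow (pow_nonneg hGa0.le _) (by positivity)
  calc 1 + ((K - jlogOf Cl K : ℕ) : ℝ) * (G / a) ^ (K - jlogOf Cl K)
      ≤ 1 + ((Cl + 1) * ((K : ℝ) + 1)) * ((G / a) * ((K : ℝ) + 1) ^ N) := by linarith
    _ = 1 + (Cl + 1) * (G / a) * ((K : ℝ) + 1) ^ (N + 1) := by rw [← hKN']; ring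
    _ ≤ ((K : ℝ) + 1) ^ (N + 1) + (Cl + 1) * (G / a) * ((K : ℝ) + 1) ^ (N + 1) := by linarith
    _ = (1 + (Cl + 1) * (G / a)) * ((K : ℝ) + 1) ^ (N + 1) := by ring

/-- **(2.43)'s RIGHT SIDE ON THE LOG WINDOW, POLYNOMIAL FORM**: under the window profile of `sum_window_le` with
`jlo = jlog(K)`, `Σ_{n=j}^{K} a^{n−j} Γ n ≤ vol·(1 + (Cl+1)(G∕a))·(K+1)^{⌈Cl·log(G∕a)⌉+1}·a^{K−j}` — the ALL-REGULAR shape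
of the route's size binder with the located polynomial weight (W-NE7-1's repair `S ≤ vol·E·(K+1)^m·a^{K−j}`). [folklore] -/
theorem sum_logWindow_le {a vol G Cl : ℝ} {Γ : ℕ → ℝ} {j K : ℕ} (ha0 : 0 < a) (ha1 : a ≤ 1) (hG : 1 ≤ G)
    (hCl : 0 ≤ Cl) (hvol : 0 ≤ vol) (hjK : j ≤ K) (hΓK : Γ K ≤ vol)
    (hΓold : ∀ n, n < K → n < jlogOf Cl K → Γ n = 0)
    (hΓwin : ∀ n, n < K → jlogOf Cl K ≤ n → Γ n ≤ vol * G ^ (K - n)) :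
    ∑ n ∈ Icc j K, a ^ (n - j) * Γ n
      ≤ vol * ((1 + (Cl + 1) * (G / a)) * ((K : ℝ) + 1) ^ (⌈Cl * Real.log (G / a)⌉₊ + 1)) * a ^ (K - j) := by
  refine (sum_window_le ha0 ha1 hG hvol hjK hΓK hΓold hΓwin).trans ?_
  exact mul_le_mul_of_nonneg_right (mul_le_mul_of_nonneg_left (windowWeight_log_le ha0 ha1 hG hCl K) hvol)
    (pow_nonneg ha0.le _)

/-! ## §2 A polynomially growing SIZE constant does not endanger `Σ_K δ_K < ∞` -/

/-- E-BRANCH with polynomial SIZE and RATE constants: `K ↦ (E(K+1)^m + C(K+1)^p)·Σ_{j+n=K} min(a^n, θ^jΛ^n)` is summable for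
`0 < a < 1`, `0 < θ < 1`, `θ ≤ Λ`, `E, C ≥ 0` (comparison with `(K+1)^{·+1} q^K`, `q = θ^σ < 1` the crossover rate of
`T4Crossover.sum_min_pow_le_crossover`; the twin of `T4TowerRateComposition.summable_eBranch_poly`, whose size constant is
`K`-free). [folklore] -/
theorem summable_eBranch_polySize {E C a θ Λ : ℝ} {m p : ℕ} (hE : 0 ≤ E) (hC : 0 ≤ C) (ha0 : 0 < a) (ha1 : a < 1)
    (hθ : 0 < θ) (hθ1 : θ < 1) (hθΛ : θ ≤ Λ) :
    Summable (fun K : ℕ =>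
      (E * ((K : ℝ) + 1) ^ m + C * ((K : ℝ) + 1) ^ p) * ∑ x ∈ antidiagonal K, min (a ^ x.2) (θ ^ x.1 * Λ ^ x.2)) := by
  set q := θ ^ (Real.log (1 / a) / (Real.log (Λ / θ) + Real.log (1 / a))) with hq
  have hq0 : 0 ≤ q := Real.rpow_nonneg hθ.le _
  have hq1 : q < 1 := crossoverRate_lt_one ha0 ha1 hθ hθ1 hθΛ
  have h1 := (summable_succ_pow_mul_geometric hq0 hq1 (m + 1)).mul_left E
  have h2 := (summable_succ_pow_mul_geometric hq0 hq1 (p + 1)).mul_left C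
  have hbound : Summable (fun K : ℕ =>
      (E * ((K : ℝ) + 1) ^ m + C * ((K : ℝ) + 1) ^ p) * (((K : ℝ) + 1) * q ^ K)) := by
    refine (h1.add h2).congr fun K => ?_
    rw [pow_succ, pow_succ]
    ring
  refine Summable.of_nonneg_of_le (fun K => ?_) (fun K => ?_) hbound
  · exact mul_nonneg (add_nonneg (mul_nonneg hE (by positivity)) (mul_nonneg hC (by positivity)))
      (Finset.sum_nonneg fun x _ =>
        le_min (pow_nonneg ha0.le _) (mul_nonneg (pow_nonneg hθ.le _) (pow_nonneg (hθ.le.trans hθΛ) _)))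
  · exact mul_le_mul_of_nonneg_left (sum_min_pow_le_crossover ha0 ha1 hθ hθΛ K)
      (add_nonneg (mul_nonneg hE (by positivity)) (mul_nonneg hC (by positivity)))

/-- **`Summable (K ↦ crossoverDeltaPoly (E·(K+1)^m) a θ Λ R₁ C p κ₀ gs w K)`** — `T4TowerRateComposition.summable_crossoverDeltaPoly`
with the SIZE constant of the E-branch allowed to grow polynomially in the cutoff (the R-branch and the slot `w` are
untouched; `κ₀ > 4` unchanged). [folklore] -/
theorem summable_crossoverDeltaPoly_polySize {E a θ Λ b β' R₁ C : ℝ} {m p κ₀ : ℕ} {g : ℕ → ℝ} {gs : ℕ → ℕ → ℝ}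
    {w : ℕ → ℝ} (hE : 0 ≤ E) (hC : 0 ≤ C) (ha0 : 0 < a) (ha1 : a < 1) (hθ : 0 < θ) (hθ1 : θ < 1) (hθΛ : θ ≤ Λ)
    (hb : 0 < b) (h031 : ∀ K, Step.Discrete031 b β' K (g K) (gs K)) (hpos : ∀ K k, k ≤ K → 0 ≤ gs K k)
    (hR₁ : 0 ≤ R₁) (hκ : 4 < κ₀) (hw : Summable w) :
    Summable (fun K : ℕ => crossoverDeltaPoly (E * ((K : ℝ) + 1) ^ m) a θ Λ R₁ C p κ₀ gs w K) := by
  obtain ⟨σ, hσ, hqσ⟩ := exists_recentRate_lt_one hθ hθ1 hθΛ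
  have h := ((summable_eBranch_polySize hE hC ha0 ha1 hθ hθ1 hθΛ (m := m) (p := p)).add
    (summable_sum_min_coupling_poly hb h031 hpos hR₁ hC hθ hθΛ hσ hqσ hκ (p := p))).add hw
  exact h.congr fun K => rfl

/-! ## §3 The route's END with the repaired size binder -/

/-- **PER-TERM RADIUS with the (2.43)-faithful size binder.**  `T4TowerRateComposition.termRadius_le_crossoverDeltaPoly` at
cutoff `K` with E-kind size radii `≤ vol·(E(K+1)^m)·a^{K−j}` (the printed right side of (2.43) on the log window, §1) in
place of the all-regular `vol·E·a^{K−j}`: the per-term radius is `≤ vol·max(Cw,1)·crossoverDeltaPoly (E(K+1)^m) … K`.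
[folklore] -/
theorem termRadius_le_crossoverDeltaPoly_polySize {SE ρE SR ρR : ℕ → ℝ} {RO vol Cw E a θ Λ R₁ C : ℝ} {m p κ₀ K : ℕ}
    {gs : ℕ → ℕ → ℝ} {w : ℕ → ℝ} (hvol : 0 ≤ vol) (hE : 0 ≤ E) (ha : 0 ≤ a) (hθ : 0 ≤ θ)
    (hΛ : 0 ≤ Λ) (hR₁ : 0 ≤ R₁) (hC : 0 ≤ C) (hgs : ∀ j ≤ K, 0 ≤ gs K j)
    (hSE : ∀ j ≤ K, SE j ≤ vol * (E * ((K : ℝ) + 1) ^ m * a ^ (K - j)))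
    (hρE : ∀ j ≤ K, ρE j ≤ Cw * vol * (C * ((K : ℝ) + 1) ^ p * θ ^ j * Λ ^ (K - j)))
    (hSR : ∀ j ≤ K, SR j ≤ vol * (R₁ * gs K j ^ κ₀))
    (hρR : ∀ j ≤ K, ρR j ≤ Cw * vol * (C * ((K : ℝ) + 1) ^ p * θ ^ j * Λ ^ (K - j)))
    (hO : RO ≤ vol * max Cw 1 * w K) :
    (∑ j ∈ range (K + 1), min (SE j) (ρE j)) + (∑ j ∈ range (K + 1), min (SR j) (ρR j)) + RO
      ≤ vol * max Cw 1 * crossoverDeltaPoly (E * ((K : ℝ) + 1) ^ m) a θ Λ R₁ C p κ₀ gs w K :=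
  termRadius_le_crossoverDeltaPoly hvol (mul_nonneg hE (by positivity)) ha hθ hΛ hR₁ hC hgs hSE hρE hSR hρR hO

/-- **THE PLUG WITH THE REPAIRED BINDER: `TermBudget` ⇒ `GoodClause` WITH `Summable δ`.**  A per-term budget whose
remainder profile is `r K = Cv·crossoverDeltaPoly (E(K+1)^m) … K` (size constants polynomial in the cutoff, as the printed
(2.43) right side on the log window demands) and whose constant-deviation profile `s` is summable gives the good clause
with `δ = r + s` AND `Summable δ` — `T4TowerRateComposition.goodClause_summable_of_termBudget` verbatim but for the weight.
CONDITIONAL on every hypothesis shape named; NE7 is NOT PRINTED and NOT proved. [folklore] -/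
theorem goodClause_summable_of_termBudget_polySize {ι : Type*} [DecidableEq ι] {l₀ vol : ℝ} {T : ℕ → Finset ι}
    {A B : ℕ → ℝ → ι → ℝ} {Bad : ℕ → ℝ → Finset ι} {Cc Rr : ℕ → ℝ → ι → ℝ} {c₀ s : ℕ → ℝ}
    {Cv E a θ Λ b β' R₁ C : ℝ} {m p κ₀ : ℕ} {g : ℕ → ℝ} {gs : ℕ → ℕ → ℝ} {w : ℕ → ℝ}
    (hT : TermBudget l₀ vol T A B Bad Cc Rr c₀
      (fun K : ℕ => Cv * crossoverDeltaPoly (E * ((K : ℝ) + 1) ^ m) a θ Λ R₁ C p κ₀ gs w K) s)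
    (hE : 0 ≤ E) (hC : 0 ≤ C) (ha0 : 0 < a) (ha1 : a < 1) (hθ : 0 < θ) (hθ1 : θ < 1) (hθΛ : θ ≤ Λ) (hb : 0 < b)
    (h031 : ∀ K, Step.Discrete031 b β' K (g K) (gs K)) (hpos : ∀ K k, k ≤ K → 0 ≤ gs K k) (hR₁ : 0 ≤ R₁)
    (hκ : 4 < κ₀) (hw : Summable w) (hs : Summable s) :
    GoodClause l₀ vol T A B Bad
        (fun K : ℕ => Cv * crossoverDeltaPoly (E * ((K : ℝ) + 1) ^ m) a θ Λ R₁ C p κ₀ gs w K + s K) ∧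
      Summable (fun K : ℕ => Cv * crossoverDeltaPoly (E * ((K : ℝ) + 1) ^ m) a θ Λ R₁ C p κ₀ gs w K + s K) :=
  ⟨goodClause_of_termBudget hT,
    ((summable_crossoverDeltaPoly_polySize hE hC ha0 ha1 hθ hθ1 hθΛ hb h031 hpos hR₁ hκ hw).mul_left Cv).add hs⟩

/-! ## §4 The input shape read off `B14.Thm2Printed` BY NAME -/

/-- The printed factor of (2.43) in the route's letter: for `L > 0`, `j ≤ n`, `(L^{j−n})^β = a^{n−j}` with `a = L^{−β}`.
[folklore] -/
theorem rpow_sub_rpow_eq_pow {L β : ℝ} (hL : 0 < L) {j n : ℕ} (hjn : j ≤ n) :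
    (L ^ ((j : ℝ) - n)) ^ β = (L ^ (-β)) ^ (n - j) := by
  rw [← Real.rpow_natCast (L ^ (-β)) (n - j), ← Real.rpow_mul hL.le, ← Real.rpow_mul hL.le, Nat.cast_sub hjn]
  congr 1
  ring

/-- The E-clause of `B14.Thm2Printed` for ONE run, ONE `(j, k, ω)`, rewritten in the route's letter `a = L^{−β}`:
`|eTerm j k ω| ≤ E₁·Σ_{n=j}^{k} a^{n−j}·gammaVol n ω`. [cite: Balaban1988Convergent, Thm 2 (2.43) p.263] -/
theorem eClause_pow_form {L β E₁ : ℝ} (hL : 0 < L) {e : ℝ} {γv : ℕ → ℝ} {j k : ℕ}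
    (h : |e| ≤ E₁ * ∑ n ∈ Icc j k, (L ^ ((j : ℝ) - n)) ^ β * γv n) :
    |e| ≤ E₁ * ∑ n ∈ Icc j k, (L ^ (-β)) ^ (n - j) * γv n := by
  refine h.trans (le_of_eq ?_)
  congr 1
  refine sum_congr rfl fun n hn => ?_
  rw [rpow_sub_rpow_eq_pow hL (mem_Icc.mp hn).1]

/-- **[III] THEOREM 2 (2.43) AS PRINTED ⇒ THE REPAIRED SIZE BINDER, BY NAME.**  From the hypothesis SHAPE `B14.Thm2Printed
H033 fam L β κ₀` (a family of runs; `β < 1`; NOT asserted — a binder), `L > 1`, `0 < β`: there is ONE constant `E ≥ 0`,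
uniform over the family, such that for every run `i` under the hypotheses of Theorem 1, every level `1 ≤ j ≤ K = (fam i).K`
and every datum `ω` whose printed volumes `n ↦ (fam i).gammaVol n ω` have the recent-log-window profile (`≥ 0`; `≤ vol` at
the top level; `= 0` below `jlog(K)`; `≤ vol·G^{K−n}` inside), the E-term obeys the route's SIZE binder with the polynomial
weight: `|(fam i).eTerm j K ω| ≤ vol·(E·(K+1)^{⌈Cl·log(G∕a)⌉+1})·a^{K−j}`, `a = L^{−β}`.  The window profile itself is a
HYPOTHESIS about Bałaban's good terms (NODE O). [cite: Balaban1988Convergent, Thm 2 (2.43) p.263] -/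
theorem sizeBinder_of_thm2Printed (H033 : Flow → ℕ → Prop) {I : Type} (fam : I → B14.Sect2Data) {L β : ℝ}
    {κ₀ : ℕ} (h : B14.Thm2Printed H033 fam L β κ₀) (hβ1 : β < 1) (hβ0 : 0 < β) (hL : 1 < L)
    {vol G Cl : ℝ} (hvol : 0 ≤ vol) (hG : 1 ≤ G) (hCl : 0 ≤ Cl) :
    ∃ E : ℝ, 0 ≤ E ∧ ∀ i : I, (fam i).flow.SatisfiesRG (fam i).K → H033 (fam i).flow (fam i).K →
      ∀ (j : ℕ) (ω : (fam i).Ω), 1 ≤ j → j ≤ (fam i).K →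
        (∀ n, 0 ≤ (fam i).gammaVol n ω) → (fam i).gammaVol (fam i).K ω ≤ vol →
        (∀ n, n < (fam i).K → n < jlogOf Cl (fam i).K → (fam i).gammaVol n ω = 0) →
        (∀ n, n < (fam i).K → jlogOf Cl (fam i).K ≤ n → (fam i).gammaVol n ω ≤ vol * G ^ ((fam i).K - n)) →
        |(fam i).eTerm j (fam i).K ω|
          ≤ vol * (E * (((fam i).K : ℝ) + 1) ^ (⌈Cl * Real.log (G / L ^ (-β))⌉₊ + 1)
              * (L ^ (-β)) ^ ((fam i).K - j)) := by
  obtain ⟨E₁, R₁, hall⟩ := h hβ1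
  have hL0 : 0 < L := one_pos.trans hL
  set a : ℝ := L ^ (-β) with ha
  have ha0 : 0 < a := Real.rpow_pos_of_pos hL0 _
  have ha1 : a ≤ 1 := Real.rpow_le_one_of_one_le_of_nonpos hL.le (by linarith)
  refine ⟨max E₁ 0 * (1 + (Cl + 1) * (G / a)), mul_nonneg (le_max_right _ _) (by
    have : 0 ≤ G / a := div_nonneg (zero_le_one.trans hG) ha0.le
    positivity), fun i hrg h033 j ω hj1 hjK hΓ0 hΓK hΓold hΓwin => ?_⟩
  obtain ⟨hE, -⟩ := hall i hrg h033
  have h1 := eClause_pow_form hL0 (hE j (fam i).K ω hj1 hjK le_rfl)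
  have hsum0 : 0 ≤ ∑ n ∈ Icc j (fam i).K, a ^ (n - j) * (fam i).gammaVol n ω :=
    Finset.sum_nonneg fun n _ => mul_nonneg (pow_nonneg ha0.le _) (hΓ0 n)
  have h2 : |(fam i).eTerm j (fam i).K ω| ≤ max E₁ 0 * ∑ n ∈ Icc j (fam i).K, a ^ (n - j) * (fam i).gammaVol n ω :=
    h1.trans (mul_le_mul_of_nonneg_right (le_max_left _ _) hsum0)
  have h3 := sum_logWindow_le (Γ := fun n => (fam i).gammaVol n ω) ha0 ha1 hG hCl hvol hjK hΓK hΓold hΓwin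
  calc |(fam i).eTerm j (fam i).K ω|
      ≤ max E₁ 0 * (vol * ((1 + (Cl + 1) * (G / a)) * (((fam i).K : ℝ) + 1) ^ (⌈Cl * Real.log (G / a)⌉₊ + 1))
          * a ^ ((fam i).K - j)) := h2.trans (mul_le_mul_of_nonneg_left h3 (le_max_right _ _))
    _ = vol * (max E₁ 0 * (1 + (Cl + 1) * (G / a)) * (((fam i).K : ℝ) + 1) ^ (⌈Cl * Real.log (G / a)⌉₊ + 1)
          * a ^ ((fam i).K - j)) := by ring

/-! ## §5 Sanity: the window profile is inhabited and the bound is attained at the top level -/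

/-- SANITY (non-vacuity of §1's hypothesis list): the ALL-REGULAR profile — `Γ K = vol`, `Γ n = 0` for `n < K` — has the
window profile for every `jlo`, and `sum_window_le` then reads `vol·a^{K−j} ≤ vol·(1 + …)·a^{K−j}`. [folklore] -/
example {a vol G : ℝ} {j jlo K : ℕ} (ha0 : 0 < a) (ha1 : a ≤ 1) (hG : 1 ≤ G) (hvol : 0 ≤ vol) (hjK : j ≤ K) :
    ∑ n ∈ Icc j K, a ^ (n - j) * (if n = K then vol else 0)
      ≤ vol * (1 + ((K - jlo : ℕ) : ℝ) * (G / a) ^ (K - jlo)) * a ^ (K - j) :=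
  sum_window_le ha0 ha1 hG hvol hjK (by simp) (fun n hn _ => by simp [hn.ne]) (fun n hn _ => by
      simp only [hn.ne, if_false]; exact mul_nonneg hvol (pow_nonneg (zero_le_one.trans hG) _))

/-! ## §6 (v1.1) The LEDGER-level budget of `T4TermwiseBudget` with the repaired size binder
`T4TermwiseBudget.termBudget_of_ledger` reads the size centring «shape of (2.43) with `n = k`» (top level only) as
`hSle : S ≤ vol·(E·a^{K−j})`, ONE `E` for all cutoffs; here the same with a profile `E K` (§1: polynomial in `K`). -/

section Ledger
open MeasureTheory T4TermwiseBudget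
variable {ι F V : Type*} [DecidableEq ι] [MeasurableSpace V] {l₀ vol : ℝ} {T : ℕ → Finset ι}
  {Bad : ℕ → ℝ → Finset ι} {A B : ℕ → ℝ → ι → ℝ} {μ : ℕ → ℝ → ι → Measure V} {Adm : ℕ → ℝ → ι → Set V}
  {fac : ℕ → ℝ → ι → Finset F} {sc : F → ℕ} {fA fB : ℕ → ℝ → ι → F → V → ℝ} {oA oB : ℕ → ℝ → ι → V → ℝ}
  {κ₁ κ₂ S ρ : ℕ → ℝ → ι → ℕ → ℝ} {cO RO : ℕ → ℝ → ι → ℝ} {c₀ s rO Cr E : ℕ → ℝ} {Cw a θ Λ : ℝ}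

/-- **NODE U5's PER-TERM BUDGET FROM A FLAT LEDGER, SIZE PROFILE CUTOFF-DEPENDENT.**  `T4TermwiseBudget.termBudget_of_ledger`
verbatim (ALL binders, none printed as a two-run statement) except that the size binder reads `S K t τ j ≤ vol·(E K·a^{K−j})`
with a nonnegative PROFILE `E : ℕ → ℝ` (§1: the printed (2.43) right side on the log window is such a profile, polynomial
in `K`).  CONCLUSION: `TermBudget` with `r K = max(Cw,1)·(E K + Cr K)·Σ_{j+n=K} min(aⁿ, θ^jΛⁿ) + rO K`. [folklore] -/
theorem termBudget_of_ledger_sizeProfile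
    (hfmtA : ∀ K t τ, A K t τ = ∫ v, (∏ i ∈ fac K t τ, fA K t τ i v) * oA K t τ v ∂(μ K t τ))
    (hfmtB : ∀ K t τ, B K t τ = ∫ v, (∏ i ∈ fac K t τ, fB K t τ i v) * oB K t τ v ∂(μ K t τ))
    (hint : ∀ K t, |t| ≤ l₀ → ∀ τ ∈ T K \ Bad K t,
      Integrable (fun v => (∏ i ∈ fac K t τ, fA K t τ i v) * oA K t τ v) (μ K t τ) ∧
        Integrable (fun v => (∏ i ∈ fac K t τ, fB K t τ i v) * oB K t τ v) (μ K t τ))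
    (hsc : ∀ K t, |t| ≤ l₀ → ∀ τ ∈ T K \ Bad K t, ∀ i ∈ fac K t τ, sc i ≤ K)
    (hpos : ∀ K t, |t| ≤ l₀ → ∀ τ ∈ T K \ Bad K t, ∀ v ∈ Adm K t τ,
      (∀ i ∈ fac K t τ, 0 < fA K t τ i v ∧ 0 < fB K t τ i v) ∧ 0 < oA K t τ v ∧ 0 < oB K t τ v)
    (hoff : ∀ K t, |t| ≤ l₀ → ∀ τ ∈ T K \ Bad K t, ∀ v, v ∉ Adm K t τ →
      (∏ i ∈ fac K t τ, fA K t τ i v) * oA K t τ v = 0 ∧ (∏ i ∈ fac K t τ, fB K t τ i v) * oB K t τ v = 0)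
    (hS : ∀ K t, |t| ≤ l₀ → ∀ τ ∈ T K \ Bad K t, ∀ v ∈ Adm K t τ, ∀ j ≤ K,
      |(∑ i ∈ fac K t τ with sc i = j, (Real.log (fB K t τ i v) - Real.log (fA K t τ i v))) - κ₁ K t τ j|
        ≤ S K t τ j)
    (hρ : ∀ K t, |t| ≤ l₀ → ∀ τ ∈ T K \ Bad K t, ∀ v ∈ Adm K t τ, ∀ j ≤ K,
      |(∑ i ∈ fac K t τ with sc i = j, (Real.log (fB K t τ i v) - Real.log (fA K t τ i v))) - κ₂ K t τ j|
        ≤ ρ K t τ j)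
    (hO : ∀ K t, |t| ≤ l₀ → ∀ τ ∈ T K \ Bad K t, ∀ v ∈ Adm K t τ,
      |Real.log (oB K t τ v) - Real.log (oA K t τ v) - cO K t τ| ≤ RO K t τ)
    (hvol : 0 ≤ vol) (hE : ∀ K, 0 ≤ E K) (ha : 0 ≤ a) (hθ : 0 ≤ θ) (hΛ : 0 ≤ Λ) (hCr : ∀ K, 0 ≤ Cr K)
    (hSle : ∀ K t, |t| ≤ l₀ → ∀ τ ∈ T K \ Bad K t, ∀ j ≤ K, S K t τ j ≤ vol * (E K * a ^ (K - j)))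
    (hρle : ∀ K t, |t| ≤ l₀ → ∀ τ ∈ T K \ Bad K t, ∀ j ≤ K,
      ρ K t τ j ≤ Cw * vol * (Cr K * θ ^ j * Λ ^ (K - j)))
    (hRO : ∀ K t, |t| ≤ l₀ → ∀ τ ∈ T K \ Bad K t, RO K t τ ≤ vol * rO K)
    (hdev : ∀ K t, |t| ≤ l₀ → ∀ τ ∈ T K \ Bad K t,
      |((∑ j ∈ range (K + 1), sliceCentre (κ₁ K t τ) (κ₂ K t τ) (S K t τ) (ρ K t τ) j) + cO K t τ) - c₀ K|
        ≤ vol * s K) :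
    TermBudget l₀ vol T A B Bad
      (fun K t τ => (∑ j ∈ range (K + 1), sliceCentre (κ₁ K t τ) (κ₂ K t τ) (S K t τ) (ρ K t τ) j) + cO K t τ)
      (fun K t τ => (∑ j ∈ range (K + 1), min (S K t τ j) (ρ K t τ j)) + RO K t τ) c₀
      (fun K => max Cw 1 * ((E K + Cr K) * ∑ x ∈ antidiagonal K, min (a ^ x.2) (θ ^ x.1 * Λ ^ x.2)) + rO K) s where
  nonneg K t ht τ hτ := by
    rw [hfmtA]
    exact (term_sandwich_of_centring (hsc K t ht τ hτ) (hpos K t ht τ hτ) (hoff K t ht τ hτ) (hS K t ht τ hτ)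
      (hρ K t ht τ hτ) (hO K t ht τ hτ) (hint K t ht τ hτ).1 (hint K t ht τ hτ).2).1
  lower K t ht τ hτ := by
    rw [hfmtA, hfmtB]
    exact (term_sandwich_of_centring (hsc K t ht τ hτ) (hpos K t ht τ hτ) (hoff K t ht τ hτ) (hS K t ht τ hτ)
      (hρ K t ht τ hτ) (hO K t ht τ hτ) (hint K t ht τ hτ).1 (hint K t ht τ hτ).2).2.1
  upper K t ht τ hτ := by
    rw [hfmtA, hfmtB]
    exact (term_sandwich_of_centring (hsc K t ht τ hτ) (hpos K t ht τ hτ) (hoff K t ht τ hτ) (hS K t ht τ hτ)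
      (hρ K t ht τ hτ) (hO K t ht τ hτ) (hint K t ht τ hτ).1 (hint K t ht τ hτ).2).2.2
  remainder K t ht τ hτ := by
    have h1 := sliceMin_le_eShape hvol (hE K) ha hθ hΛ (hCr K) (hSle K t ht τ hτ) (hρle K t ht τ hτ)
    have h2 := hRO K t ht τ hτ
    show (∑ j ∈ range (K + 1), min (S K t τ j) (ρ K t τ j)) + RO K t τ
      ≤ vol * (max Cw 1 * ((E K + Cr K) * ∑ x ∈ antidiagonal K, min (a ^ x.2) (θ ^ x.1 * Λ ^ x.2)) + rO K)
    rw [mul_add]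
    exact add_le_add h1 h2
  deviation K t ht τ hτ := hdev K t ht τ hτ
/-- **THE GOOD CLAUSE WITH `Summable δ` FROM THE LEDGER BUDGET, POLYNOMIAL SIZE AND RATE PROFILES**
(`T4TermwiseBudget.goodClause_summable_of_ledgerBudget_poly` with size constant `E₀·(K+1)^m` in place of `E`):
`δ = r + s`, `r K = max(Cw,1)·(E₀(K+1)^m + Cr₀(K+1)^p)·Σ_{j+n=K} min(aⁿ, θ^jΛⁿ) + rO K`, summable by `summable_eBranch_polySize`
(`0 < a < 1`, `0 < θ < 1`, `θ ≤ Λ`; `rO`, `s` summable — binders).  The weight half `RelWeightBound` (NE7b) is not this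
file's.  CONDITIONAL on every binder named; NE7 is NOT PRINTED and NOT proved. [folklore] -/
theorem goodClause_summable_of_ledgerBudget_polySize {Cc Rr : ℕ → ℝ → ι → ℝ} {E₀ Cr₀ : ℝ} {m p : ℕ}
    (hT : TermBudget l₀ vol T A B Bad Cc Rr c₀
      (fun K => max Cw 1 * ((E₀ * ((K : ℝ) + 1) ^ m + Cr₀ * ((K : ℝ) + 1) ^ p) *
        ∑ x ∈ antidiagonal K, min (a ^ x.2) (θ ^ x.1 * Λ ^ x.2)) + rO K) s)
    (hE₀ : 0 ≤ E₀) (hCr₀ : 0 ≤ Cr₀) (ha0 : 0 < a) (ha1 : a < 1) (hθ0 : 0 < θ) (hθ1 : θ < 1) (hθΛ : θ ≤ Λ)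
    (hrO : Summable rO) (hs : Summable s) :
    GoodClause l₀ vol T A B Bad
        (fun K => (max Cw 1 * ((E₀ * ((K : ℝ) + 1) ^ m + Cr₀ * ((K : ℝ) + 1) ^ p) *
          ∑ x ∈ antidiagonal K, min (a ^ x.2) (θ ^ x.1 * Λ ^ x.2)) + rO K) + s K) ∧
      Summable (fun K : ℕ => (max Cw 1 * ((E₀ * ((K : ℝ) + 1) ^ m + Cr₀ * ((K : ℝ) + 1) ^ p) *
          ∑ x ∈ antidiagonal K, min (a ^ x.2) (θ ^ x.1 * Λ ^ x.2)) + rO K) + s K) :=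
  ⟨goodClause_of_termBudget hT,
    (((summable_eBranch_polySize hE₀ hCr₀ ha0 ha1 hθ0 hθ1 hθΛ (m := m) (p := p)).mul_left (max Cw 1)).add hrO).add hs⟩

end Ledger
end Summit.QuantumFields.YangMills.BalabanUVNodes.N19SizeWindow
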